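import Literature.Computability.Complexity.TVCheckerRun
import HarnessLib

/-!
# `FP` bricks for the downward checker of Trevisan–Vadhan's language, V: parsing the input length —
# the size `nOf`, the stage `iOf`, the layout numbers and the modulus — and the whole checker

Literature / complexity — fifth machine layer of the downward checker (sequel of `TVCheckerRun.lean`).
Trevisan–Vadhan's function `F` reads the size `n` and the stage `i` off the LENGTH of its input
(`TVFunction.lean`: `nOf`, `iOf`, the canonical lengths `h n i` inside the slot `[pre n, pre (n+1))`);
the checker does the same, in unary, before running the core verdict of `TVCheckerRun`:

* `TVChk.maxOf`, `DnOf`, `blkOf`, `ptLenOf'`, `mlenOf`, `slotOf` — the layout numbers of a size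
  given in unary (`blk t = |bin (Dn t + 1)|`, `QBFUniv.size_Dn_succ`); `TVChk.preOf` (`1^{pre n}`, a
  concatenation fold); **`TVChk.nOfF`** — `1^{nOf |w|}` by the count `nOf k = #{t < k | pre (t+1) ≤ k}`
  (`QBFUniv.nOf_eq_card`), a counted fold carrying `1^{pre (t+1)}`;
* `TVChk.modOf` — the modulus `modStr (Mof n)` by the modulus search of `HardLangMachine`
  (`modSearchF`, fuel `6 (|w| + 1)²  ≥ 2^{Mof n + 1}`, `QBFUniv.Dn_succ_le`);
* `TVChk.coreOf` (the core record of `TVCheckerPointBricks`) and **`TVChk.tvCheckFn acc`** — THE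
  CHECKER on `⟨⟨w, r⟩, e⟩`: reject non-canonical lengths, accept the (trivial) size-`0` words, else the
  core verdict; `tvCheckFn_mem_FP`; and its case analysis **`tvCheckFn_cases`** matching `QBFUniv.FB`:
  `[false]` off the canonical lengths (where `FB = false`), `[true]` at size `0` (where `FB = true`,
  `Fni_size_zero`), and `chkCoreF` (`= [allBelow 64 checksOf]`, `TVCheckerRun.chkCoreF_apply`) otherwise.

Everything is proved; definitions are `FP` string functions (no named facts, D-0026).

## References

* L. Trevisan, S. Vadhan, Comput. Complexity 16 (2007), Thm. 4.3 (proof: "for lengths `k` not of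
  the form `h(n,i)` …"; the machine parses `n, i` from the length) [TrevisanVadhan2007].
* R. Santhanam, SIAM J. Comput. 39 (2009), Lemma 12 [Santhanam2009].
* S. Arora, B. Barak, CUP 2009, §1.3 [AroraBarakCC2009].
-/

noncomputable section

namespace Literature.Computability.Complexity

namespace TVChk

open _root_.Computability Polynomial Finset Brick Plumb GF2Str HardLangM TVBrick QBFUniv SelfCorrect
  Literature.InformationTheory.Coding

/-! ### The layout numbers of a size given in unary -/

section Layout

variable (G : List Bool → List Bool)

/-- `1^{max 3 (2t)}` from `G z = 1ᵗ`. [folklore] -/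
def maxOf : List Bool → List Bool :=
  iteFn (ltLenF ∘ fanoutFn (appF ∘ fanoutFn G G) (fun _ => ones 3)) (fun _ => ones 3) (appF ∘ fanoutFn G G)

/-- `1^{Dn t}` (`Dn t = N t · max 3 (2t)`). [folklore] -/
def DnOf : List Bool → List Bool :=
  HashBricks.umulFn ∘ fanoutFn (dropFn ∘ fanoutFn (fun _ => [true]) (nSuccOf ∘ G)) (maxOf G)

/-- `1^{blk t}` (`blk t = Mof t + 1 = |bin (Dn t + 1)|`). [folklore] -/
def blkOf : List Bool → List Bool := polyFn X ∘ lenBinF ∘ List.cons true ∘ DnOf G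

/-- `1^{ptLen t}` (`N t · blk t`). [folklore] -/
def ptLenOf' : List Bool → List Bool :=
  HashBricks.umulFn ∘ fanoutFn (dropFn ∘ fanoutFn (fun _ => [true]) (nSuccOf ∘ G)) (blkOf G)

/-- `1^{mlen t}` (`t (N t + 1)`). [folklore] -/
def mlenOf : List Bool → List Bool := HashBricks.umulFn ∘ fanoutFn G (nSuccOf ∘ G)

/-- `1^{slot t}` (`ptLen t + blk t + mlen t + 1`). [folklore] -/
def slotOf : List Bool → List Bool :=
  List.cons true ∘ appF ∘ fanoutFn (appF ∘ fanoutFn (ptLenOf' G) (blkOf G)) (mlenOf G)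

variable {G}

/-- These are in `FP` (for `G ∈ FP`). [folklore] -/
theorem layout_mem_FP (hG : G ∈ FP) :
    maxOf G ∈ FP ∧ DnOf G ∈ FP ∧ blkOf G ∈ FP ∧ ptLenOf' G ∈ FP ∧ mlenOf G ∈ FP ∧ slotOf G ∈ FP := by
  have hGG : appF ∘ fanoutFn G G ∈ FP := comp_mem_FP appF_mem_FP (fanoutFn_mem_FP hG hG)
  have hmax : maxOf G ∈ FP := iteFn_mem_FP (comp_mem_FP ltLenF_mem_FP (fanoutFn_mem_FP hGG (const_mem_FP _))) (const_mem_FP _) hGG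
  have hN : (dropFn ∘ fanoutFn (fun _ => [true]) (nSuccOf ∘ G) : List Bool → List Bool) ∈ FP :=
    comp_mem_FP dropFn_mem_FP (fanoutFn_mem_FP (const_mem_FP _) (comp_mem_FP nSuccOf_mem_FP hG))
  have hDn : DnOf G ∈ FP := comp_mem_FP HashBricks.umulFn_mem_FP (fanoutFn_mem_FP hN hmax)
  have hblk : blkOf G ∈ FP := comp_mem_FP (polyFn_mem_FP _) (comp_mem_FP lenBinF_mem_FP (comp_mem_FP (cons_mem_FP true) hDn))
  have hpt : ptLenOf' G ∈ FP := comp_mem_FP HashBricks.umulFn_mem_FP (fanoutFn_mem_FP hN hblk)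
  have hml : mlenOf G ∈ FP := comp_mem_FP HashBricks.umulFn_mem_FP (fanoutFn_mem_FP hG (comp_mem_FP nSuccOf_mem_FP hG))
  exact ⟨hmax, hDn, hblk, hpt, hml, comp_mem_FP (cons_mem_FP true) (comp_mem_FP appF_mem_FP (fanoutFn_mem_FP
    (comp_mem_FP appF_mem_FP (fanoutFn_mem_FP hpt hblk)) hml))⟩

/-- **Values of the layout bricks** on an argument with `G z = 1ᵗ`. [folklore] -/
theorem layout_apply {z : List Bool} {t : ℕ} (hz : G z = ones t) :
    maxOf G z = ones (max 3 (2 * t)) ∧ DnOf G z = ones (Dn t) ∧ blkOf G z = ones (blk t) ∧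
    ptLenOf' G z = ones (ptLen t) ∧ mlenOf G z = ones (mlen t) ∧ slotOf G z = ones (slot t) := by
  have hGG : (appF ∘ fanoutFn G G) z = ones (2 * t) := by
    rw [Function.comp_apply, fanoutFn_apply, hz, appF_boolPair, ones, List.replicate_append_replicate, two_mul]
  have hmax : maxOf G z = ones (max 3 (2 * t)) := by
    have hc : (ltLenF ∘ fanoutFn (appF ∘ fanoutFn G G) (fun _ => ones 3)) z = [decide (2 * t < 3)] := by
      rw [Function.comp_apply, fanoutFn_apply, hGG, ltLenF_boolPair]; simp [ones]
    rw [maxOf, iteFn_apply hc]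
    by_cases h : 2 * t < 3
    · rw [decide_eq_true h, if_pos rfl, max_eq_left (by omega)]
    · rw [decide_eq_false h, if_neg Bool.false_ne_true, hGG, max_eq_right (by omega)]
  have hN : (dropFn ∘ fanoutFn (fun _ => [true]) (nSuccOf ∘ G)) z = ones (N t) := by
    rw [Function.comp_apply, fanoutFn_apply, Function.comp_apply, hz, nSuccOf_apply, dropFn_boolPair]; simp [ones]
  have hDn : DnOf G z = ones (Dn t) := by
    rw [DnOf, Function.comp_apply, fanoutFn_apply, hN, hmax, HashBricks.umulFn_apply, fstF_boolPair, sndF_boolPair]; simp [ones, Dn]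
  have hblk : blkOf G z = ones (blk t) := by
    rw [blkOf, Function.comp_apply, Function.comp_apply, Function.comp_apply, hDn, polyFn_apply, lenBinF_apply, eval_X,
      List.length_cons, TM2Pass.length_encodeNat_eq_size]
    simp only [ones, List.length_replicate, size_Dn_succ]
  have hpt : ptLenOf' G z = ones (ptLen t) := by
    rw [ptLenOf', Function.comp_apply, fanoutFn_apply, hN, hblk, HashBricks.umulFn_apply, fstF_boolPair, sndF_boolPair]; simp [ones, ptLen]
  have hml : mlenOf G z = ones (mlen t) := by
    rw [mlenOf, Function.comp_apply, fanoutFn_apply, hz, Function.comp_apply, hz, nSuccOf_apply, HashBricks.umulFn_apply, fstF_boolPair,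
      sndF_boolPair]
    simp [ones, mlen, length_uops]
  refine ⟨hmax, hDn, hblk, hpt, hml, ?_⟩
  rw [slotOf, Function.comp_apply, Function.comp_apply, fanoutFn_apply, Function.comp_apply, fanoutFn_apply, hpt, hblk, hml, appF_boolPair,
    appF_boolPair]
  simp only [ones, List.replicate_append_replicate, ← List.replicate_succ, slot]

end Layout

/-! ### `1^{pre n}` and `1^{nOf k}` (contexts padded to cubic length) -/

/-- The slots are quintic in the size (crudely: `Mof t + 1 ≤ Dn t + 1`). [folklore] -/
theorem slot_le (t : ℕ) : slot t ≤ 30 * (t + 1) ^ 5 := by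
  have hN : N t = 2 * (t * t) + 2 * t := N_eq t
  have hM : Mof t + 1 ≤ Dn t + 1 := by
    have := (Mof_spec t).1
    have h2 : Mof t < 2 ^ Mof t := Nat.lt_two_pow_self
    omega
  have hu : 1 ≤ t + 1 := by omega
  have hsq : (t + 1) ^ 2 = t * t + 2 * t + 1 := by ring
  have hu1 : N t ≤ 2 * (t + 1) ^ 2 := by rw [hN, hsq]; omega
  have hmx : max 3 (2 * t) ≤ 3 * (t + 1) := by omega
  have hD : Dn t + 1 ≤ 7 * (t + 1) ^ 3 := by
    rw [Dn]
    have := Nat.mul_le_mul hu1 hmx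
    have h3 : (t + 1) ^ 2 * (t + 1) = (t + 1) ^ 3 := by ring
    have h4 : 1 ≤ (t + 1) ^ 3 := Nat.one_le_pow _ _ hu
    nlinarith
  have hM' : Mof t + 1 ≤ 7 * (t + 1) ^ 3 := hM.trans hD
  have hA : N t * (Mof t + 1) ≤ 2 * (t + 1) ^ 2 * (7 * (t + 1) ^ 3) := Nat.mul_le_mul hu1 hM'
  have hB : t * (N t + 1) ≤ (t + 1) * (2 * (t + 1) ^ 2 + 1) := Nat.mul_le_mul (by omega) (by omega)
  have h5 : 2 * (t + 1) ^ 2 * (7 * (t + 1) ^ 3) = 14 * (t + 1) ^ 5 := by ring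
  have h6 : (t + 1) * (2 * (t + 1) ^ 2 + 1) = 2 * (t + 1) ^ 3 + (t + 1) := by ring
  have h7 : (t + 1) ^ 3 ≤ (t + 1) ^ 5 := Nat.pow_le_pow_right hu (by norm_num)
  have h8 : t + 1 ≤ (t + 1) ^ 5 := by
    calc t + 1 = (t + 1) ^ 1 := (pow_one _).symm
      _ ≤ (t + 1) ^ 5 := Nat.pow_le_pow_right hu (by norm_num)
  rw [slot, ptLen, mlen, length_uops, show blk t = Mof t + 1 from rfl]
  rw [h5] at hA
  rw [h6] at hB
  omega

/-- **`1^{pre n}`** on `⟨1ⁿ, pad⟩` (`|pad| ≥ 30 n⁵`): the concatenation of the slots `t < n`. [folklore] -/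
def preOf : List Bool → List Bool :=
  sndPow 2 ∘ foldLoop appF (clipF 1 (slotOf sndF)) X ∘ fanoutFn (fun z => z) (fanoutFn (lenBinF ∘ fstF) (fun _ => boolPair [] []))

/-- `preOf ∈ FP`. [folklore] -/
theorem preOf_mem_FP : preOf ∈ FP :=
  comp_mem_FP (sndPow_mem_FP 2) (comp_mem_FP (foldLoop_clipF_mem_FP 1 appF_mem_FP length_appF_le (layout_mem_FP sndF_mem_FP).2.2.2.2.2 _)
    (fanoutFn_mem_FP (PolyTimeComputable.id _) (fanoutFn_mem_FP (comp_mem_FP lenBinF_mem_FP fstF_mem_FP) (const_mem_FP _))))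

/-- `ccat` of the slots is `pre`. [folklore] -/
theorem ccat_slot : ∀ n, ccat (fun t => ones (slot t)) n = ones (pre n)
  | 0 => rfl
  | n + 1 => by rw [ccat_succ, ccat_slot n, pre, ones, ones, ones, List.replicate_append_replicate]

/-- **Value of `preOf`.** [folklore] -/
theorem preOf_apply (n : ℕ) (pad : List Bool) (hpad : 30 * n ^ 5 ≤ pad.length) : preOf (boolPair (ones n) pad) = ones (pre n) := by
  have hk : n ≤ (X : Polynomial ℕ).eval (boolPair (ones n) pad).length := by
    simp only [eval_X, length_boolPair, ones, List.length_replicate]; omega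
  have hinit : (fanoutFn (fun z => z) (fanoutFn (lenBinF ∘ fstF) (fun _ => boolPair [] []))) (boolPair (ones n) pad) =
      boolPair (boolPair (ones n) pad) (boolPair (encodeNat n) (boolPair (ones 0) [])) := by simp [ones]
  have hpiece : ∀ t, slotOf sndF (boolPair (boolPair (ones n) pad) (ones t)) = ones (slot t) := fun t =>
    (layout_apply (G := sndF) (sndF_boolPair _ _)).2.2.2.2.2
  rw [preOf, Function.comp_apply, Function.comp_apply, hinit, foldLoop_apply _ _ hk, sndPow_succ_boolPair, sndPow_succ_boolPair,
    sndPow_zero_boolPair, foldAcc_clipF (fun t _ ht => ?_), foldAcc_appF, List.nil_append]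
  · rw [show (fun j => slotOf sndF (boolPair (boolPair (ones n) pad) (ones (0 + j)))) = fun t => ones (slot t)
      from funext fun t => by rw [Nat.zero_add, hpiece], ccat_slot]
  · rw [hpiece, ones, List.length_replicate, length_boolPair, ones, List.length_replicate, one_mul]
    have h1 := slot_le t
    have h2 : (t + 1) ^ 5 ≤ n ^ 5 := Nat.pow_le_pow_left (by omega) 5
    omega

/-- The counting operation on `⟨⟨1ᴾ, 1ᶜ⟩, ⟨1ˢ, w⟩⟩`: `⟨1^{P+S}, (P + S ≤ |w| ? 1 :: 1ᶜ : 1ᶜ)⟩`, clipped. [folklore] -/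
def cntOpF : List Bool → List Bool :=
  clipOp (fanoutFn (appF ∘ fanoutFn (fstF ∘ fstF) (fstF ∘ sndF))
    (iteFn (ltLenF ∘ fanoutFn (appF ∘ fanoutFn (fstF ∘ fstF) (fstF ∘ sndF)) (List.cons true ∘ sndF ∘ sndF))
      (List.cons true ∘ sndF ∘ fstF) (sndF ∘ fstF)))

/-- `cntOpF ∈ FP`. [folklore] -/
theorem cntOpF_mem_FP : cntOpF ∈ FP := by
  have hPS : (appF ∘ fanoutFn (fstF ∘ fstF) (fstF ∘ sndF) : List Bool → List Bool) ∈ FP :=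
    comp_mem_FP appF_mem_FP (fanoutFn_mem_FP (comp_mem_FP fstF_mem_FP fstF_mem_FP) (comp_mem_FP fstF_mem_FP sndF_mem_FP))
  exact clipOp_mem_FP (fanoutFn_mem_FP hPS (iteFn_mem_FP (comp_mem_FP ltLenF_mem_FP (fanoutFn_mem_FP hPS
    (comp_mem_FP (cons_mem_FP true) (comp_mem_FP sndF_mem_FP sndF_mem_FP))))
    (comp_mem_FP (cons_mem_FP true) (comp_mem_FP sndF_mem_FP fstF_mem_FP)) (comp_mem_FP sndF_mem_FP fstF_mem_FP)))

/-- Value of the counting operation. [folklore] -/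
theorem cntOpF_apply (P c S : ℕ) (w : List Bool) :
    cntOpF (boolPair (boolPair (ones P) (ones c)) (boolPair (ones S) w)) =
      boolPair (ones (P + S)) (ones (if P + S ≤ w.length then c + 1 else c)) := by
  have hraw : (fanoutFn (appF ∘ fanoutFn (fstF ∘ fstF) (fstF ∘ sndF))
      (iteFn (ltLenF ∘ fanoutFn (appF ∘ fanoutFn (fstF ∘ fstF) (fstF ∘ sndF)) (List.cons true ∘ sndF ∘ sndF))
        (List.cons true ∘ sndF ∘ fstF) (sndF ∘ fstF))) (boolPair (boolPair (ones P) (ones c)) (boolPair (ones S) w)) =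
      boolPair (ones (P + S)) (ones (if P + S ≤ w.length then c + 1 else c)) := by
    have hc : (ltLenF ∘ fanoutFn (appF ∘ fanoutFn (fstF ∘ fstF) (fstF ∘ sndF)) (List.cons true ∘ sndF ∘ sndF))
        (boolPair (boolPair (ones P) (ones c)) (boolPair (ones S) w)) = [decide (P + S ≤ w.length)] := by
      simp only [Function.comp_apply, fanoutFn_apply, fstF_boolPair, sndF_boolPair, appF_boolPair, ltLenF_boolPair, List.length_append,
        ones, List.length_replicate, List.length_cons]
      congr 1; exact Bool.decide_congr (by omega)
    rw [fanoutFn_apply, iteFn_apply hc]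
    by_cases h : P + S ≤ w.length
    · rw [decide_eq_true h, if_pos rfl, if_pos h]
      simp only [Function.comp_apply, fanoutFn_apply, fstF_boolPair, sndF_boolPair, appF_boolPair, ones, List.replicate_append_replicate]
      rfl
    · rw [decide_eq_false h, if_neg Bool.false_ne_true, if_neg h]
      simp only [Function.comp_apply, fanoutFn_apply, fstF_boolPair, sndF_boolPair, appF_boolPair, ones, List.replicate_append_replicate]
  rw [cntOpF, clipOp_eq, hraw]
  rw [hraw, fstF_boolPair, sndF_boolPair]
  simp only [length_boolPair, ones, List.length_replicate]
  split_ifs <;> omega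

/-- The counting piece on `⟨⟨w, pad⟩, 1ᵗ⟩`: `⟨1^{slot t}, w⟩`. [folklore] -/
def cntPieceF : List Bool → List Bool := fanoutFn (slotOf sndF) (fstF ∘ fstF)

/-- `cntPieceF ∈ FP`. [folklore] -/
theorem cntPieceF_mem_FP : cntPieceF ∈ FP :=
  fanoutFn_mem_FP (layout_mem_FP sndF_mem_FP).2.2.2.2.2 (comp_mem_FP fstF_mem_FP fstF_mem_FP)

/-- Value of the counting piece. [folklore] -/
theorem cntPieceF_apply (w pad : List Bool) (t : ℕ) : cntPieceF (boolPair (boolPair w pad) (ones t)) = boolPair (ones (slot t)) w := by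
  rw [cntPieceF, fanoutFn_apply, (layout_apply (G := sndF) (sndF_boolPair _ _)).2.2.2.2.2, Function.comp_apply, fstF_boolPair, fstF_boolPair]

/-- The model of the counting fold: after `k` rounds, `⟨1^{pre k}, 1^{#{t < k | pre (t+1) ≤ |w|}}⟩`. [folklore] -/
theorem cnt_foldAcc (w pad : List Bool) : ∀ k,
    foldAcc cntOpF cntPieceF (boolPair w pad) 0 k (boolPair (ones 0) (ones 0)) =
      boolPair (ones (pre k)) (ones (((range k).filter fun t => pre (t + 1) ≤ w.length).card))
  | 0 => by simp [pre]
  | k + 1 => by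
    rw [foldAcc_succ', cnt_foldAcc w pad k, Nat.zero_add, cntPieceF_apply, cntOpF_apply, Finset.range_add_one, filter_insert]
    have hpre : pre k + slot k = pre (k + 1) := rfl
    rw [hpre]
    by_cases h : pre (k + 1) ≤ w.length
    · rw [if_pos h, if_pos h, card_insert_of_notMem (by simp)]
    · rw [if_neg h, if_neg h]

/-- **`1^{nOf |w|}`** on `⟨w, pad⟩` (`|pad| ≥ 30 |w|⁵`): the count of the sizes whose slot starts below
`|w|` (`QBFUniv.nOf_eq_card`). [cite: TrevisanVadhan2007, Thm. 4.3 (proof)] -/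
def nOfF : List Bool → List Bool :=
  sndF ∘ sndPow 2 ∘ foldLoop cntOpF (clipF 3 cntPieceF) X ∘ fanoutFn (fun z => z) (fanoutFn (lenBinF ∘ fstF) (fun _ => boolPair [] (boolPair [] [])))

/-- `nOfF ∈ FP`. [folklore] -/
theorem nOfF_mem_FP : nOfF ∈ FP :=
  comp_mem_FP sndF_mem_FP (comp_mem_FP (sndPow_mem_FP 2) (comp_mem_FP (foldLoop_clipF_mem_FP 3 cntOpF_mem_FP (length_clipOp_le _)
    cntPieceF_mem_FP _) (fanoutFn_mem_FP (PolyTimeComputable.id _) (fanoutFn_mem_FP (comp_mem_FP lenBinF_mem_FP fstF_mem_FP) (const_mem_FP _)))))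

/-- **Value of `nOfF`.** [cite: TrevisanVadhan2007, Thm. 4.3 (proof)] -/
theorem nOfF_apply (w pad : List Bool) (hpad : 30 * w.length ^ 5 ≤ pad.length) : nOfF (boolPair w pad) = ones (nOf w.length) := by
  have hk : w.length ≤ (X : Polynomial ℕ).eval (boolPair w pad).length := by simp only [eval_X, length_boolPair]; omega
  have hinit : (fanoutFn (fun z => z) (fanoutFn (lenBinF ∘ fstF) (fun _ => boolPair [] (boolPair [] [])))) (boolPair w pad) =
      boolPair (boolPair w pad) (boolPair (encodeNat w.length) (boolPair (ones 0) (boolPair (ones 0) (ones 0)))) := by simp [ones]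
  rw [nOfF, Function.comp_apply, Function.comp_apply, Function.comp_apply, hinit, foldLoop_apply _ _ hk, sndPow_succ_boolPair,
    sndPow_succ_boolPair, sndPow_zero_boolPair, foldAcc_clipF (fun t _ ht => ?_), cnt_foldAcc, sndF_boolPair, nOf_eq_card]
  rw [cntPieceF_apply, length_boolPair, length_boolPair, ones, List.length_replicate]
  have h1 := slot_le t
  have h2 : (t + 1) ^ 5 ≤ w.length ^ 5 := Nat.pow_le_pow_left (by omega) 5
  omega

/-! ### Parsing the input record `⟨⟨w, r⟩, e⟩` -/

section Parse

/-- `w` of the input record. [folklore] -/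
def pW : List Bool → List Bool := fstF ∘ fstF
/-- `r` of the input record. [folklore] -/
def pR : List Bool → List Bool := sndF ∘ fstF
/-- `e` of the input record. [folklore] -/
def pE : List Bool → List Bool := sndF
/-- The pad `1^{30 |w|⁵}` of the parsing folds. [folklore] -/
def padW : List Bool → List Bool := polyFn (30 * X ^ 5) ∘ pW
/-- **The size `1ⁿ`, `n = nOf |w|`.** [cite: TrevisanVadhan2007, Thm. 4.3 (proof)] -/
def szU : List Bool → List Bool := nOfF ∘ fanoutFn pW padW
/-- `1^{pre n}`. [folklore] -/
def preN : List Bool → List Bool := preOf ∘ fanoutFn szU padW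
/-- `1^{pre n + ptLen n + blk n}` (the shortest canonical length `h n (mlen n)` of size `n`). [folklore] -/
def baseN : List Bool → List Bool := appF ∘ fanoutFn (appF ∘ fanoutFn preN (ptLenOf' szU)) (blkOf szU)
/-- **Canonical length?** `[pre n + ptLen n + blk n ≤ |w|]`. [cite: TrevisanVadhan2007, Thm. 4.3 (proof)] -/
def canonU : List Bool → List Bool := ltLenF ∘ fanoutFn baseN (List.cons true ∘ pW)
/-- **The stage `1ⁱ`, `i = iOf |w|`.** [cite: TrevisanVadhan2007, Thm. 4.3 (proof)] -/
def stU : List Bool → List Bool := dropFn ∘ fanoutFn (dropFn ∘ fanoutFn baseN pW) (mlenOf szU)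
/-- `1^{m'}`, `m' = mlen n - i`. [folklore] -/
def mU : List Bool → List Bool := dropFn ∘ fanoutFn stU (mlenOf szU)
/-- `1ᶻ`, `Z = pre n + m'`. [folklore] -/
def ZU : List Bool → List Bool := appF ∘ fanoutFn preN mU
/-- **The modulus `modStr (Mof n)`** by the modulus search (fuel `6 (|w|+1)²`). [folklore] -/
def modN : List Bool → List Bool := modSearchF ∘ fanoutFn (blkOf szU) (polyFn (6 * (X + 1) ^ 2) ∘ pW)
/-- **The core record** assembled from the input record. [folklore] -/
def coreU : List Bool → List Bool :=
  fanoutFn (fanoutFn pW pR) (fanoutFn pE (fanoutFn szU (fanoutFn stU (fanoutFn mU (fanoutFn ZU modN)))))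

/-- The parsing bricks are in `FP`. [folklore] -/
theorem parse_mem_FP : pW ∈ FP ∧ pR ∈ FP ∧ pE ∈ FP ∧ szU ∈ FP ∧ canonU ∈ FP ∧ coreU ∈ FP := by
  have hW : pW ∈ FP := comp_mem_FP fstF_mem_FP fstF_mem_FP
  have hR : pR ∈ FP := comp_mem_FP sndF_mem_FP fstF_mem_FP
  have hpad : padW ∈ FP := comp_mem_FP (polyFn_mem_FP _) hW
  have hn : szU ∈ FP := comp_mem_FP nOfF_mem_FP (fanoutFn_mem_FP hW hpad)
  obtain ⟨-, -, hblk, hpt, hml, -⟩ := layout_mem_FP hn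
  have hpre : preN ∈ FP := comp_mem_FP preOf_mem_FP (fanoutFn_mem_FP hn hpad)
  have hbase : baseN ∈ FP := comp_mem_FP appF_mem_FP (fanoutFn_mem_FP (comp_mem_FP appF_mem_FP (fanoutFn_mem_FP hpre hpt)) hblk)
  have hi : stU ∈ FP := comp_mem_FP dropFn_mem_FP (fanoutFn_mem_FP (comp_mem_FP dropFn_mem_FP (fanoutFn_mem_FP hbase hW)) hml)
  have hm : mU ∈ FP := comp_mem_FP dropFn_mem_FP (fanoutFn_mem_FP hi hml)
  have hZ : ZU ∈ FP := comp_mem_FP appF_mem_FP (fanoutFn_mem_FP hpre hm)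
  have hmod : modN ∈ FP := comp_mem_FP modSearchF_mem_FP (fanoutFn_mem_FP hblk (comp_mem_FP (polyFn_mem_FP _) hW))
  exact ⟨hW, hR, sndF_mem_FP, hn, comp_mem_FP ltLenF_mem_FP (fanoutFn_mem_FP hbase (comp_mem_FP (cons_mem_FP true) hW)),
    fanoutFn_mem_FP (fanoutFn_mem_FP hW hR) (fanoutFn_mem_FP sndF_mem_FP (fanoutFn_mem_FP hn (fanoutFn_mem_FP hi (fanoutFn_mem_FP hm
      (fanoutFn_mem_FP hZ hmod)))))⟩

/-- **Values of the parsing bricks** on `⟨⟨w, r⟩, e⟩`, `n = nOf |w|`, `i = iOf |w|`. [cite: TrevisanVadhan2007, Thm. 4.3 (proof)] -/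
theorem parse_apply (w r e : List Bool) :
    szU (boolPair (boolPair w r) e) = ones (nOf w.length) ∧
    canonU (boolPair (boolPair w r) e) = [decide (pre (nOf w.length) + ptLen (nOf w.length) + blk (nOf w.length) ≤ w.length)] ∧
    stU (boolPair (boolPair w r) e) = ones (iOf w.length) ∧
    mU (boolPair (boolPair w r) e) = ones (mlen (nOf w.length) - iOf w.length) ∧
    ZU (boolPair (boolPair w r) e) = ones (pre (nOf w.length) + (mlen (nOf w.length) - iOf w.length)) ∧
    (ptLen (nOf w.length) ≤ w.length → modN (boolPair (boolPair w r) e) = modStr (Mof (nOf w.length))) := by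
  set In := boolPair (boolPair w r) e with hIn
  set n := nOf w.length with hn
  have hW : pW In = w := by simp [pW, hIn]
  have hpad : padW In = ones (30 * w.length ^ 5) := by
    rw [padW, Function.comp_apply, hW, polyFn_apply]; simp
  have hszU : szU In = ones n := by
    rw [szU, Function.comp_apply, fanoutFn_apply, hW, hpad, nOfF_apply _ _ (by simp [ones])]
  obtain ⟨-, -, hblk, hpt, hml, -⟩ := layout_apply (G := szU) hszU
  have hnle : n ≤ w.length := nOf_le _
  have hpre : preN In = ones (pre n) := by
    rw [preN, Function.comp_apply, fanoutFn_apply, hszU, hpad, preOf_apply _ _ ?_]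
    simp only [ones, List.length_replicate]
    exact Nat.mul_le_mul_left _ (Nat.pow_le_pow_left hnle 5)
  have hbase : baseN In = ones (pre n + ptLen n + blk n) := by
    rw [baseN, Function.comp_apply, fanoutFn_apply, Function.comp_apply, fanoutFn_apply, hpre, hpt, hblk, appF_boolPair, appF_boolPair]
    simp only [ones, List.replicate_append_replicate]
  have hstU : stU In = ones (iOf w.length) := by
    rw [stU, Function.comp_apply, fanoutFn_apply, Function.comp_apply, fanoutFn_apply, hbase, hW, hml, dropFn_boolPair, dropFn_boolPair,
      List.length_drop, iOf, ← hn]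
    simp only [ones, List.length_replicate, List.drop_replicate]
    have e1 : mlen n - (w.length - (pre n + ptLen n + blk n)) = mlen n - (w.length - pre n - ptLen n - blk n) := by omega
    rw [e1]
  have hmU : mU In = ones (mlen n - iOf w.length) := by
    rw [mU, Function.comp_apply, fanoutFn_apply, hstU, hml, dropFn_boolPair]
    simp only [ones, List.length_replicate, List.drop_replicate]
  refine ⟨hszU, ?_, hstU, hmU, ?_, fun hwl => ?_⟩
  · rw [canonU, Function.comp_apply, fanoutFn_apply, hbase, Function.comp_apply, hW, ltLenF_boolPair]
    simp only [ones, List.length_replicate, List.length_cons, Nat.lt_succ_iff]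
  · rw [ZU, Function.comp_apply, fanoutFn_apply, hpre, hmU, appF_boolPair]
    simp only [ones, List.replicate_append_replicate]
  · rw [modN, Function.comp_apply, fanoutFn_apply, hblk, Function.comp_apply, hW, polyFn_apply]
    refine modSearchF_apply (Mof n) _ ?_
    simp only [eval_mul, eval_pow, eval_add, eval_X, eval_one, eval_ofNat, ones, List.length_replicate]
    have h1 := two_pow_Mof_succ_le n
    have h2 := Dn_succ_le n
    have h3 : (ptLen n + 1) ^ 2 ≤ (w.length + 1) ^ 2 := Nat.pow_le_pow_left (by omega) 2
    omega

/-- **The core record assembled** (`ptLen n ≤ |w|`). [folklore] -/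
theorem coreU_apply (w r e : List Bool) (hw : ptLen (nOf w.length) ≤ w.length) :
    coreU (boolPair (boolPair w r) e) =
      coreRec w r e (nOf w.length) (iOf w.length) (mlen (nOf w.length) - iOf w.length)
        (pre (nOf w.length) + (mlen (nOf w.length) - iOf w.length)) (modStr (Mof (nOf w.length))) := by
  obtain ⟨hn, -, hi, hm, hZ, hmod⟩ := parse_apply w r e
  have hW : pW (boolPair (boolPair w r) e) = w := by simp [pW]
  have hR : pR (boolPair (boolPair w r) e) = r := by simp [pR]
  have hE : pE (boolPair (boolPair w r) e) = e := by simp [pE]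
  simp only [coreU, fanoutFn_apply, hW, hR, hE, hn, hi, hm, hZ, hmod hw, coreRec]

/-- **THE DOWNWARD CHECKER of Trevisan–Vadhan's language**, on `⟨⟨w, r⟩, e⟩` against the oracle
presented by the access brick `acc` on the carrier `e`: reject off the canonical lengths, accept at
size `0`, else the conjunction of the sixty-four LFKN runs. [cite: Santhanam2009, Lemma 12] [cite: TrevisanVadhan2007, Thm. 5.4] -/
def tvCheckFn (acc : List Bool → List Bool) : List Bool → List Bool :=
  iteFn canonU (iteFn (isNilFn ∘ szU) (fun _ => [true]) (chkCoreF acc ∘ coreU)) (fun _ => [false])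

/-- **`tvCheckFn acc ∈ FP` for `acc ∈ FP`.** [cite: Santhanam2009, Lemma 12 ("probabilistic polynomial-time oracle Turing machine")] -/
theorem tvCheckFn_mem_FP {acc : List Bool → List Bool} (hacc : acc ∈ FP) : tvCheckFn acc ∈ FP := by
  obtain ⟨-, -, -, hn, hc, hcore⟩ := parse_mem_FP
  exact iteFn_mem_FP hc (iteFn_mem_FP (comp_mem_FP isNilFn_mem_FP hn) (const_mem_FP _) (comp_mem_FP (chkCoreF_mem_FP hacc) hcore))
    (const_mem_FP _)

/-- The canonical-length condition of `FB` in additive form. [folklore] -/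
theorem canonical_iff (k : ℕ) :
    ptLen (nOf k) + blk (nOf k) ≤ k - pre (nOf k) ↔ pre (nOf k) + ptLen (nOf k) + blk (nOf k) ≤ k := by
  have := (nOf_spec k).1; omega

/-- **The three cases of the checker.** [cite: TrevisanVadhan2007, Thm. 4.3 (proof)] -/
theorem tvCheckFn_cases (acc : List Bool → List Bool) (w r e : List Bool) :
    (¬ ptLen (nOf w.length) + blk (nOf w.length) ≤ w.length - pre (nOf w.length) ∧ tvCheckFn acc (boolPair (boolPair w r) e) = [false]) ∨
    (ptLen (nOf w.length) + blk (nOf w.length) ≤ w.length - pre (nOf w.length) ∧ nOf w.length = 0 ∧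
      tvCheckFn acc (boolPair (boolPair w r) e) = [true]) ∨
    (ptLen (nOf w.length) + blk (nOf w.length) ≤ w.length - pre (nOf w.length) ∧ 0 < nOf w.length ∧
      tvCheckFn acc (boolPair (boolPair w r) e) =
        chkCoreF acc (coreRec w r e (nOf w.length) (iOf w.length) (mlen (nOf w.length) - iOf w.length)
          (pre (nOf w.length) + (mlen (nOf w.length) - iOf w.length)) (modStr (Mof (nOf w.length))))) := by
  obtain ⟨hn, hc, -, -, -, -⟩ := parse_apply w r e
  have hz : (isNilFn ∘ szU) (boolPair (boolPair w r) e) = [decide (nOf w.length = 0)] := by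
    rw [Function.comp_apply, hn, isNilFn]; simp [ones, List.replicate_eq_nil_iff]
  by_cases hcan : pre (nOf w.length) + ptLen (nOf w.length) + blk (nOf w.length) ≤ w.length
  · have hcan' := (canonical_iff w.length).2 hcan
    rcases Nat.eq_zero_or_pos (nOf w.length) with h0 | hpos
    · refine Or.inr (Or.inl ⟨hcan', h0, ?_⟩)
      rw [tvCheckFn, iteFn_apply hc, decide_eq_true hcan, if_pos rfl, iteFn_apply hz, decide_eq_true h0, if_pos rfl]
    · refine Or.inr (Or.inr ⟨hcan', hpos, ?_⟩)
      rw [tvCheckFn, iteFn_apply hc, decide_eq_true hcan, if_pos rfl, iteFn_apply hz, decide_eq_false (by omega), if_neg Bool.false_ne_true,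
        Function.comp_apply, coreU_apply w r e (by omega)]
  · refine Or.inl ⟨fun h => hcan ((canonical_iff w.length).1 h), ?_⟩
    rw [tvCheckFn, iteFn_apply hc, decide_eq_false hcan, if_neg Bool.false_ne_true]

end Parse

/-! ### Size zero -/

/-- At size `0` the field exponent is `0`. [folklore] -/
theorem Mof_zero : Mof 0 = 0 := by rw [Mof, Dn, N_eq]; simp

/-- **At size `0` the function is `1` on the canonical lengths** (`f_{0,0}` is the empty product `1`
and the selector is `0`). [folklore] -/
theorem Fni_size_zero (i : ℕ) (w : List Bool) : Fni 0 i w = true := by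
  have hm : mlen 0 = 0 := by rw [mlen, length_uops]; simp
  rw [Fni, fam_of_length_le (by rw [← mlen, hm]; exact Nat.zero_le _)]
  have hmat : matrixPoly (K 0) 0 = 1 := by rw [matrixPoly]; simp
  rw [hmat, map_one, encF_one]
  simp only [decide_eq_true_eq]
  have hb : blk 0 = 1 := by rw [show blk 0 = Mof 0 + 1 from rfl, Mof_zero]
  have := (jOf 0 w).isLt.trans_eq hb
  omega

end TVChk

end Literature.Computability.Complexity

end
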